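import Literature.Analysis.FluidPDE.FractionalNSReynolds
import Literature.Analysis.FluidPDE.FracLaplacianSmooth
import Literature.Analysis.FluidPDE.AntidivergenceLinear
import Literature.Analysis.FluidPDE.NavierStokesConcentrationTools
import Literature.Analysis.FluidPDE.TorusForceBookkeeping
import Literature.Analysis.FunctionSpaces.TorusLerayHelmholtzSpaceTime
import HarnessLib

/-!
# The start of Luo–Titi's iteration: a smooth compactly supported field as a solution of the
  fractional Navier–Stokes–Reynolds system

Analysis/FluidPDE proofs-only file. T. Luo, E. S. Titi, *Non-uniqueness of weak solutions to
hyperviscous Navier–Stokes equations: on sharpness of J.-L. Lions exponent*, Calc. Var. PDE 59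
(2020) = arXiv:1808.07595, §2.1, proof of Theorem 1, first step: "Let `v₀ = u`. Then
`∫ ∂ₜv₀ dx = d/dt ∫ v₀ dx ≡ 0`. Let `R₀ = ℛ(∂ₜv₀ + ν(-Δ)^θ v₀) + v₀ ⊗ v₀ + p₀ I`, … where `ℛ` is
the symmetric anti-divergence operator … Clearly `(v₀, R₀)` solves (2.1)" — i.e. every smooth,
divergence-free, mean-zero field with compact support in time is the velocity of a smooth
solution of the fractional Navier–Stokes–Reynolds system (`Torus.IsFracNSReynoldsOn`,
`FractionalNSReynolds`) whose stress has the same temporal support. We prove this on the tree's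
unit torus `T^d` (`2 ≤ #d`), with zero pressure and the (not trace-free) stress
`R₀ = ℛ(∂ₜu + ν(-Δ)^θ u) + u ⊗ u`, `ℛ` the De Lellis–Székelyhidi antidivergence of
`FluidPDE/Antidivergence` (`div ℛf = f - ∫ f`; Luo–Titi do not ask `R` to be trace free, and the
printed `p₀ I` only moves the trace):

* `Torus.isSmoothSpaceTimeOn_fracLaplacian` — for `u` smooth on `ℝ × T^d` vanishing off a compact
  time interval and `θ ≥ 0`, `(t, x) ↦ ((-Δ)^θ u(t))(x)` is smooth on `ℝ × T^d` (parametric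
  Fourier synthesis `Torus.isSmoothSpaceTimeOn_tsum_mFourier_smul` of
  `TorusLerayHelmholtzSpaceTime`: the slice coefficients and all their time derivatives decay
  faster than any power of `|k|`, uniformly in time, and the symbol `(4π²|k|²)^θ` has polynomial
  growth);
* `Torus.mFourierCoeff_const`, `Torus.integral_fracLaplacian_eq_zero` — `(-Δ)^θ a` has zero
  mean for smooth `a` and `θ > 0` (its zero mode carries the factor `σ_θ(0) = 0`);
* `Torus.exists_isFracNSReynoldsOn_of_forall_hasZeroMean` — the statement quoted above: for
  `θ > 0`, any `ν`, and `u` smooth on `ℝ × T^d`, divergence free and mean zero at every time,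
  with `u(t) = 0` for `t ∉ [a, b]`, there is a stress `R` with
  `Torus.IsFracNSReynoldsOn univ θ ν u 0 R` and `R(t) = 0` for `t ∉ [a, b]`.

## References

* T. Luo, E. S. Titi, Calc. Var. PDE 59 (2020), Paper 92 = arXiv:1808.07595, §2.1, proof of
  Theorem 1 (p. 4 of the arXiv text). [`LuoTiti2020`]
* L. Grafakos, *Classical Fourier Analysis*, 3rd ed. (2014), Prop. 3.2.6 (8), §3.3.1
  (coefficients of smooth functions; multipliers of polynomial growth). [`Grafakos2014`]
-/

noncomputable section

open MeasureTheory Set Filter Function UnitAddTorus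
open scoped ENNReal NNReal InnerProductSpace ContDiff

namespace Literature.Analysis.FluidPDE

namespace Torus

open FunctionSpaces.Torus

variable {d : Type*} [Fintype d] [DecidableEq d]

/-! ## `(-Δ)^θ` of a jointly smooth field with compact time support -/

section FracLaplacian

/-- **`(t, x) ↦ ((-Δ)^θ u(t))(x)` is smooth on `ℝ × T^d`** for `u` smooth on `ℝ × T^d` with
`u(t) = 0` off a compact time interval `[a, b]`, and `θ ≥ 0`. Proof: the modes of `(-Δ)^θ u(t)`
are `e_k(x) σ_θ(k) û(t)(k)` with `σ_θ(k) = (4π²|k|²)^θ ≤ (4π²)^θ (1 + |k|²)^⌈θ⌉`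
(`Torus.fracSymbol_le_mul_pow`), while all time derivatives of the slice coefficients
`t ↦ û(t)(k)` decay faster than any power of `|k|` uniformly in `t`
(`Torus.exists_norm_iteratedDeriv_mFourierCoeff_slice_le`); the parametric synthesis
`Torus.isSmoothSpaceTimeOn_tsum_mFourier_smul` and the real part conclude (Grafakos 2014,
§3.3.1 with a parameter). [folklore] -/
theorem isSmoothSpaceTimeOn_fracLaplacian {θ : ℝ} (hθ : 0 ≤ θ)
    {u : ℝ → UnitAddTorus d → EuclideanSpace ℝ d} (hu : FunctionSpaces.Torus.IsSmoothSpaceTimeOn univ u)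
    {a b : ℝ} (h0 : ∀ t ∉ Icc a b, u t = 0) :
    FunctionSpaces.Torus.IsSmoothSpaceTimeOn univ (fun t => fracLaplacian θ (u t)) := by
  set c : (d → ℤ) → ℝ → EuclideanSpace ℂ d := fun k t =>
    ((fracSymbol θ k : ℝ) : ℂ) • mFourierCoeff (FunctionSpaces.EuclideanSpace.complexify ∘ u t) k
    with hc_def
  have hcs : ∀ k, ContDiff ℝ ∞ (c k) := fun k =>
    (FunctionSpaces.Torus.contDiff_mFourierCoeff_slice hu k).const_smul _
  have hcb : ∀ n m : ℕ, ∃ C : ℝ, ∀ k t, ‖iteratedDeriv n (c k) t‖ ≤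
      C * ((1 + FunctionSpaces.Torus.freqNormSq k) ^ m)⁻¹ := by
    intro n m
    obtain ⟨C, hC⟩ := FunctionSpaces.Torus.exists_norm_iteratedDeriv_mFourierCoeff_slice_le hu h0 n (⌈θ⌉₊ + m)
    refine ⟨(4 * Real.pi ^ 2) ^ θ * max C 0, fun k t => ?_⟩
    have hq : 0 < 1 + FunctionSpaces.Torus.freqNormSq k := by linarith [FunctionSpaces.Torus.freqNormSq_nonneg k]
    have hderiv : iteratedDeriv n (c k) t = ((fracSymbol θ k : ℝ) : ℂ) •
        iteratedDeriv n (fun s => mFourierCoeff (FunctionSpaces.EuclideanSpace.complexify ∘ u s) k) t :=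
      iteratedDeriv_fun_const_smul_field _ _
    rw [hderiv, norm_smul, Complex.norm_real, Real.norm_of_nonneg (fracSymbol_nonneg θ k)]
    have h2 : ‖iteratedDeriv n
        (fun s => mFourierCoeff (FunctionSpaces.EuclideanSpace.complexify ∘ u s) k) t‖ ≤
        max C 0 * ((1 + FunctionSpaces.Torus.freqNormSq k) ^ (⌈θ⌉₊ + m))⁻¹ :=
      (hC k t).trans (mul_le_mul_of_nonneg_right (le_max_left _ _)
        (inv_nonneg.2 (pow_nonneg hq.le _)))
    calc fracSymbol θ k * ‖iteratedDeriv n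
          (fun s => mFourierCoeff (FunctionSpaces.EuclideanSpace.complexify ∘ u s) k) t‖
        ≤ ((4 * Real.pi ^ 2) ^ θ * (1 + FunctionSpaces.Torus.freqNormSq k) ^ ⌈θ⌉₊) *
            (max C 0 * ((1 + FunctionSpaces.Torus.freqNormSq k) ^ (⌈θ⌉₊ + m))⁻¹) :=
          mul_le_mul (fracSymbol_le_mul_pow hθ k) h2 (norm_nonneg _) (by positivity)
      _ = (4 * Real.pi ^ 2) ^ θ * max C 0 * ((1 + FunctionSpaces.Torus.freqNormSq k) ^ m)⁻¹ := by
          rw [pow_add]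
          field_simp
  have hsynth := (FunctionSpaces.Torus.isSmoothSpaceTimeOn_tsum_mFourier_smul hcs hcb).clm_comp
    FunctionSpaces.EuclideanSpace.realPart
  have hfun : (fun t => fracLaplacian θ (u t)) = fun t x =>
      FunctionSpaces.EuclideanSpace.realPart (∑' k : d → ℤ, mFourier k x • c k t) := by
    funext t x
    rw [fracLaplacian_def]
    congr 1
    exact tsum_congr fun k => fracSymbol_smul_mFourier_smul θ k x _
  rw [hfun]
  exact hsynth

omit [DecidableEq d] in
/-- Fourier coefficients of a constant: `𝓕(x ↦ v)(n) = v` for `n = 0` and `0` otherwise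
(`∫ e_{-n} = δ_{n,0}`). [folklore] -/
theorem mFourierCoeff_const {E : Type*} [NormedAddCommGroup E] [NormedSpace ℂ E] [CompleteSpace E]
    (v : E) (n : d → ℤ) :
    mFourierCoeff (fun _ : UnitAddTorus d => v) n = if n = 0 then v else 0 := by
  rw [FunctionSpaces.Torus.mFourierCoeff_eq_integral_volume, integral_smul_const,
    FunctionSpaces.Torus.integral_mFourier]
  by_cases hn : n = 0
  · subst hn; simp
  · simp [hn]

/-- **`(-Δ)^θ a` has zero mean** for smooth `a` and `θ > 0`: pairing with a constant `e`,
`∫ ⟪e, (-Δ)^θ a⟫ = ∑ₖ σ_θ(k) Re ⟪ê(k), â(k)⟫ = σ_θ(0) Re ⟪e, â(0)⟫ = 0`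
(`Torus.integral_inner_fracLaplacian_eq_tsum`, `σ_θ(0) = 0`). [folklore] -/
theorem integral_fracLaplacian_eq_zero {θ : ℝ} (hθ : 0 < θ)
    {a : UnitAddTorus d → EuclideanSpace ℝ d} (ha : FunctionSpaces.Torus.IsSmooth a) :
    ∫ x, fracLaplacian θ a x = 0 := by
  refine ext_inner_left ℝ fun e => ?_
  rw [inner_zero_right, ← integral_inner (integrable_fracLaplacian hθ.le ha) e,
    integral_inner_fracLaplacian_eq_tsum hθ.le ha continuous_const]
  have hcoef : ∀ k : d → ℤ,
      mFourierCoeff (FunctionSpaces.EuclideanSpace.complexify ∘ fun _ : UnitAddTorus d => e) k =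
        if k = 0 then FunctionSpaces.EuclideanSpace.complexify e else 0 := fun k =>
    mFourierCoeff_const _ k
  have hterm : ∀ k : d → ℤ, fracSymbol θ k *
      (⟪mFourierCoeff (FunctionSpaces.EuclideanSpace.complexify ∘ fun _ : UnitAddTorus d => e) k,
        mFourierCoeff (FunctionSpaces.EuclideanSpace.complexify ∘ a) k⟫_ℂ).re = 0 := by
    intro k
    by_cases hk : k = 0
    · subst hk
      rw [fracSymbol_zero hθ.ne', zero_mul]
    · rw [hcoef k, if_neg hk, inner_zero_left, Complex.zero_re, mul_zero]
  simp_rw [hterm, tsum_zero]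

end FracLaplacian

/-! ## The tensor square of the zero field -/

section Zero

omit [Fintype d] [DecidableEq d] in
/-- `0 ⊗ 0 = 0`. [folklore] -/
theorem tensorProd_zero :
    tensorProd (0 : UnitAddTorus d → EuclideanSpace ℝ d) 0 = 0 := by
  funext y j
  simp [tensorProd]

end Zero

/-! ## The initial triple `(u, 0, ℛ(∂ₜu + ν(-Δ)^θu) + u ⊗ u)` -/

section Initial

/-- **Luo–Titi's starting point of the iteration** (§2.1, proof of Theorem 1: "Let `v₀ = u`. Then
`∫ ∂ₜv₀ = d/dt ∫ v₀ ≡ 0`. Let `R₀ = ℛ(∂ₜv₀ + ν(-Δ)^θv₀) + v₀ ⊗ v₀ + p₀I` … Clearly `(v₀, R₀)`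
solves (2.1)"). On `T^d`, `2 ≤ #d`, `θ > 0`, any `ν`: if `u` is smooth on `ℝ × T^d`, divergence
free and of zero mean at every time, and `u(t) = 0` for `t ∉ [a, b]`, then with the force
`f = ∂ₜu + ν(-Δ)^θ u` (jointly smooth, `Torus.isSmoothSpaceTimeOn_fracLaplacian`; mean zero,
`∫ ∂ₜu = d/dt ∫ u = 0` and `Torus.integral_fracLaplacian_eq_zero`) the stress
`R = ℛf + u ⊗ u` (`ℛ` the De Lellis–Székelyhidi antidivergence, `div ℛf = f - ∫ f = f`;
`div (u ⊗ u) = (u·∇)u` as `div u = 0`) is symmetric, jointly smooth, vanishes for `t ∉ [a, b]`,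
and `(u, 0, R)` is a smooth solution of the fractional Navier–Stokes–Reynolds system on
`ℝ × T^d`: `∂ₜu + (u·∇)u + ∇0 + ν(-Δ)^θ u = div R`. (Zero pressure; the printed `p₀ I`,
`p₀ = -|v₀|²/3`, only makes the stress trace free, which `Torus.IsFracNSReynoldsOn` does not
require.) [cite: LuoTiti2020, §2.1, proof of Theorem 1 (first step)] -/
theorem exists_isFracNSReynoldsOn_of_forall_hasZeroMean (hd : 2 ≤ Fintype.card d) {θ : ℝ}
    (hθ : 0 < θ) (ν : ℝ) {u : ℝ → UnitAddTorus d → EuclideanSpace ℝ d}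
    (hu : FunctionSpaces.Torus.IsSmoothSpaceTimeOn univ u) (hdiv : ∀ t, FunctionSpaces.Torus.IsDivFree (u t))
    (hmean : ∀ t, FunctionSpaces.Torus.HasZeroMean (u t)) {a b : ℝ} (h0 : ∀ t ∉ Icc a b, u t = 0) :
    ∃ R : ℝ → UnitAddTorus d → d → EuclideanSpace ℝ d,
      IsFracNSReynoldsOn univ θ ν u (fun _ _ => 0) R ∧ ∀ t ∉ Icc a b, R t = 0 := by
  -- the force `f = ∂ₜu + ν(-Δ)^θ u`
  set f : ℝ → UnitAddTorus d → EuclideanSpace ℝ d := fun t y =>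
    FunctionSpaces.Torus.timeDeriv u t y + ν • fracLaplacian θ (u t) y with hf_def
  have hdt : FunctionSpaces.Torus.IsSmoothSpaceTimeOn univ (FunctionSpaces.Torus.timeDeriv u) := hu.timeDeriv
  have hΛ : FunctionSpaces.Torus.IsSmoothSpaceTimeOn univ (fun t => fracLaplacian θ (u t)) :=
    isSmoothSpaceTimeOn_fracLaplacian hθ.le hu h0
  have hf : FunctionSpaces.Torus.IsSmoothSpaceTimeOn univ f := hdt.add (hΛ.const_smul ν)
  have hft : ∀ t, FunctionSpaces.Torus.IsSmooth (f t) := fun t => hf.isSmooth_slice (mem_univ t)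
  have hut : ∀ t, FunctionSpaces.Torus.IsSmooth (u t) := fun t => hu.isSmooth_slice (mem_univ t)
  have hdtt : ∀ t, FunctionSpaces.Torus.IsSmooth (FunctionSpaces.Torus.timeDeriv u t) := fun t => hdt.isSmooth_slice (mem_univ t)
  have hΛt : ∀ t, FunctionSpaces.Torus.IsSmooth (fracLaplacian θ (u t)) := fun t => hΛ.isSmooth_slice (mem_univ t)
  -- zero mean of the force
  have hf0 : ∀ t, ∫ y, f t y = 0 := by
    intro t
    have h1 : ∫ y, FunctionSpaces.Torus.timeDeriv u t y = 0 := by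
      have h := hasZeroMean_timeDerivWithin_univ hu hmean t
      rw [timeDerivWithin_univ] at h
      exact h
    have h2 : ∫ y, fracLaplacian θ (u t) y = 0 := integral_fracLaplacian_eq_zero hθ (hut t)
    have hi1 : Integrable (FunctionSpaces.Torus.timeDeriv u t) volume := (hdtt t).integrable
    have hi2 : Integrable (fun y => ν • fracLaplacian θ (u t) y) volume :=
      (integrable_fracLaplacian hθ.le (hut t)).smul ν
    change ∫ y, (FunctionSpaces.Torus.timeDeriv u t y + ν • fracLaplacian θ (u t) y) = 0
    rw [integral_add hi1 hi2, integral_smul, h1, h2, smul_zero, add_zero]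
  -- joint smoothness of the two pieces of the stress
  have hA : FunctionSpaces.Torus.IsSmoothSpaceTimeOn univ (fun t => antidivergence (f t)) :=
    hf.antidivergence convex_univ (by simp)
  have hT : FunctionSpaces.Torus.IsSmoothSpaceTimeOn univ (fun t => tensorProd (u t) (u t)) := by
    unfold FunctionSpaces.Torus.IsSmoothSpaceTimeOn
    refine contDiffOn_pi.2 fun j => ?_
    exact (hu.apply j).smul hu
  refine ⟨fun t x => antidivergence (f t) x + tensorProd (u t) (u t) x, ?_, ?_⟩
  · refine
      { smooth_velocity := hu
        smooth_pressure := FunctionSpaces.Torus.isSmoothSpaceTimeOn_const (FunctionSpaces.Torus.isSmooth_const (0 : ℝ)) univ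
        smooth_stress := hA.add hT
        momentum := ?_
        divFree := fun t _ => hdiv t
        symm := ?_ }
    · intro t _ x
      have hdivR : tensorDivergence (fun y => antidivergence (f t) y + tensorProd (u t) (u t) y) x =
          tensorDivergence (antidivergence (f t)) x + tensorDivergence (tensorProd (u t) (u t)) x :=
        tensorDivergence_add_apply ((isSmooth_antidivergence (hft t)).isContDiff (by simp))
          (((hut t).tensorProd (hut t)).isContDiff (by simp)) x
      rw [hdivR, tensorDivergence_antidivergence hd (hft t) x, hf0 t, sub_zero,
        tensorDivergence_tensorProd (hut t) (hut t) x, hdiv t x, zero_smul, add_zero,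
        timeDerivWithin_univ, gradient_zero, add_zero]
      change FunctionSpaces.Torus.timeDeriv u t x + FunctionSpaces.Torus.convect (u t) (u t) x + ν • fracLaplacian θ (u t) x =
        (FunctionSpaces.Torus.timeDeriv u t x + ν • fracLaplacian θ (u t) x) + FunctionSpaces.Torus.convect (u t) (u t) x
      abel
    · intro t _ x i j
      change antidivergence (f t) x i j + tensorProd (u t) (u t) x i j =
        antidivergence (f t) x j i + tensorProd (u t) (u t) x j i
      rw [antidivergence_symm (hft t) x i j, tensorProd_apply, tensorProd_apply, mul_comm]
  · intro t ht
    have hu0 : u t = 0 := h0 t ht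
    have hd0 : FunctionSpaces.Torus.timeDeriv u t = 0 := by
      have h := FunctionSpaces.Torus.iterate_timeDeriv_eq_zero_of_forall_not_mem isClosed_Icc h0 1 t ht
      rwa [Function.iterate_one] at h
    have hft0 : f t = 0 := by
      funext y
      change FunctionSpaces.Torus.timeDeriv u t y + ν • fracLaplacian θ (u t) y = 0
      rw [hd0, hu0, fracLaplacian_zero_fun]
      simp
    funext x j
    change antidivergence (f t) x j + tensorProd (u t) (u t) x j = 0
    rw [hft0, hu0, antidivergence_zero, tensorProd_zero]
    simp

end Initial

end Torus

end Literature.Analysis.FluidPDE
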